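import Mathlib
import HarnessLib
import Literature.MathematicalPhysics.QuantumLattice.GrassmannEffectiveActionScales
import Literature.MathematicalPhysics.QuantumLattice.GrassmannEffectiveActionTruncationDB
import Literature.MathematicalPhysics.QuantumLattice.GrassmannWeightedEffectiveActionBoundDB
import Literature.MathematicalPhysics.QuantumLattice.SectorisedEffectiveActionBoundWeightedPlateau
import Literature.MathematicalPhysics.QuantumLattice.SectorisedKernelNormPrescribedBridge
import Summits.HubbardSuperconductivity.HubbardSuperconductivity.Theorems.KLProgrammeKLRegimeEngineTowerBlockStepLev
import Summits.HubbardSuperconductivity.HubbardSuperconductivity.Theorems.KLProgrammeKLRegimeEngineTowerBlockIncrWt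

/-!
# Route `KLProgramme` — crux K3 ENGINE (stmt-HubbardSuperconductivity-20437 `KLRegimeEngineV17F2`), stub (b) v2 / class #3 (E.5 share):
# THE PARTITION FUNCTION ALONG THE BLOCKS IS A UNIT — the shared input «(Z)» `Z^K_{Λ_j} ≠ 0`
# (cell gate-hubbard-kl, seat gate-hubbard-kl-p5 g13; E1-LEVELS-BLUEPRINT-g8 §1/§4 «OPEN (Z ≠ 0 along the blocks)», RA-U-SUPPLY-g11 §7.3 item 5)

Every tower / carrier file of the (ℓ) package and of the E.5 share carries the hypothesis
`hZ : hubbardEffPartitionFnCT L M β U μ 0 K (klScale klE0 j) ≠ 0` (semigroup `klEffectiveAction_eq_effAction_slice`,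
`constPart_klEffectiveAction_eq_zero`, `klTowerIncr_eq_effAction_sub`, `klE5Carrier_odd_le_zero_pointAugment`, …).  This file supplies it
from data the tower induction discharges ANYWAY:

* §1 (generic scale, any frame `K`, any seed `h`) `hubbardEffPartitionFnCT_eq_mul_slice`:
  `Z^K_Λ = Z^K_{Λ′} · ∫dμ_{C^K_{(Λ,Λ′]}} e^{−𝒢^K_{Λ′}}` (Literature `effPartitionFn_add_of_isUnit` ∘ `hubbardCovAboveCT_eq_slice_add`), hence
  `hubbardEffPartitionFnCT_ne_zero_of_slice` (`Z^K_{Λ′} ≠ 0`, step partition function a unit `⇒ Z^K_Λ ≠ 0`); the ultraviolet end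
  `hubbardEffPartitionFnCT_eq_one_of_weight` (`C^K_{>Λ} = 0 ⇒ Z^K_Λ = 1`);
* §2 (kl-scales, E1's blocks `J_k = d·k`) `hubbardEffPartitionFnCT_klScale_ne_zero_of_step`, `…_succ_ne_zero_of_steps` (scale by scale) and
  **`hubbardEffPartitionFnCT_klScale_blocks_ne_zero`**: `Z^K_{Λ_0} ≠ 0 ∧ (∀ k < m, Z^K_{Λ_{dk}} ≠ 0 → IsUnit ∫dμ_{Γ_k} e^{−𝒱_{dk}[K]}) ⇒ ∀ k ≤ m, Z^K_{Λ_{dk}} ≠ 0`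
  (`Γ_k = C^K_{(Λ_{d(k+1)},Λ_{dk}]}`, `𝒱_{dk}[K] = klTowerInput … d k` — LITERALLY the covariance / input of `klTowerIncr_eq_effAction_sub`);
* §3 (Literature-level, plateau) `isUnit_effPartitionFn_of_plateau_wt` / `isUnit_effPartitionFn_of_plateau_prescribed`: the STEP partition function
  `∫dμ_C e^{−G}` is a unit from the determinant-bounded doors' first conjuncts (`sum_wt_norm_kernel_effAction_le_of_gramBounded .1`,
  `sum_norm_kernel_effAction_add_sum_cumulant_le_of_gramBounded .1`) read through the plateau identity
  `effPartitionFn_map_sectorSub_sectorPreimage_of_plateau` — hypotheses = those of the Literature (Hstep) doors MINUS the output data;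
* §4 (E1's block geometry) **`isUnit_effPartitionFn_blockStep_wt`** / **`isUnit_effPartitionFn_blockStep_lev`**: the unit `IsUnit ∫dμ_{Γ} e^{−G}`,
  `Γ = hubbardCovSliceCT … (klScale klE0 J₂) (klScale klE0 J₁)`, under EXACTLY the hypotheses of E1's `blockStep_ordersGe2_wt_le` /
  `blockStep_ordersGe2_lev_le` (…EngineTowerBlockStepWt / …Lev) minus `J′, cr, cc, N₀` and the output pin — so the tower induction carries
  `Z ≠ 0` at zero extra analytic cost (same `κ, α, ρ, θ < 1` it discharges for the kernels).
The base `Z^K_{Λ_0} ≠ 0` at every admissible frame under the stub binders is the sibling file `…EngineScaleZeroPartitionFnUnit`.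
Everything is proved; no definitions, no named facts, no sorry; nothing asserts superconductivity.
References: Salmhofer 1999 §2.5.1 (2.105)–(2.106) [cite: Salmhofer1999]; BGM 2006 §2.3 (2.13)–(2.14), §2.7 (2.70), §3 (3.2)–(3.8)
[cite: BenfattoGiulianiMastropietro2006].
-/

noncomputable section

namespace Summit.HubbardSuperconductivity.HubbardSuperconductivity.Theorems.EngineV8

set_option linter.dupNamespace false -- summit = problem name (single-conjunct summit), D-0017

open Real Finset Literature.MathematicalPhysics.QuantumLattice Literature.Probability.LatticeModels GrassmannAlgebra
open Summit.HubbardSuperconductivity.HubbardSuperconductivity.Theorems.KLProgrammeLegKernels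
open Summit.HubbardSuperconductivity.HubbardSuperconductivity.Theorems.KLRegimeSplit
open Literature.Probability.LatticeModels.BattleFederbush

/-! ## §1 Generic scale: the partition functions multiply along a slice -/

section Slice

variable {L M : ℕ} [NeZero L] (β U μ h : ℝ) (K : TrigPolyC4v)

/-- **The partition functions multiply along a slice** (Salmhofer 1999 (2.105) in the normalised convention):
`Z^K_Λ = Z^K_{Λ′} · ∫dμ_{C^K_{(Λ,Λ′]}} e^{−𝒢^K_{Λ′}}` whenever `Z^K_{Λ′} ≠ 0`. -/
theorem hubbardEffPartitionFnCT_eq_mul_slice (Λ : ℝ) {Λ' : ℝ} (hZ : hubbardEffPartitionFnCT L M β U μ h K Λ' ≠ 0) :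
    hubbardEffPartitionFnCT L M β U μ h K Λ =
      hubbardEffPartitionFnCT L M β U μ h K Λ' *
        effPartitionFn ℂ (hubbardCovSliceCT L M β μ h K Λ Λ') (hubbardEffectiveActionCT L M β U μ h K Λ') := by
  have hZ' : IsUnit (effPartitionFn ℂ (hubbardCovAboveCT L M β μ h K Λ') (hubbardInteractionCT L M β U K)) :=
    isUnit_iff_ne_zero.2 hZ
  unfold hubbardEffPartitionFnCT hubbardEffectiveActionCT
  rw [hubbardCovAboveCT_eq_slice_add L M β μ h K Λ Λ', effPartitionFn_add_of_isUnit _ _ _ hZ']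

/-- **Unit propagation along a slice**: `Z^K_{Λ′} ≠ 0` and `∫dμ_{C^K_{(Λ,Λ′]}} e^{−𝒢^K_{Λ′}}` a unit `⇒ Z^K_Λ ≠ 0`. -/
theorem hubbardEffPartitionFnCT_ne_zero_of_slice (Λ : ℝ) {Λ' : ℝ} (hZ : hubbardEffPartitionFnCT L M β U μ h K Λ' ≠ 0)
    (hstep : IsUnit (effPartitionFn ℂ (hubbardCovSliceCT L M β μ h K Λ Λ') (hubbardEffectiveActionCT L M β U μ h K Λ'))) :
    hubbardEffPartitionFnCT L M β U μ h K Λ ≠ 0 := by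
  rw [hubbardEffPartitionFnCT_eq_mul_slice β U μ h K Λ hZ]
  exact mul_ne_zero hZ hstep.ne_zero

/-- `IsUnit` form of `hubbardEffPartitionFnCT_ne_zero_of_slice`. -/
theorem isUnit_hubbardEffPartitionFnCT_of_slice (Λ : ℝ) {Λ' : ℝ} (hZ : IsUnit (hubbardEffPartitionFnCT L M β U μ h K Λ'))
    (hstep : IsUnit (effPartitionFn ℂ (hubbardCovSliceCT L M β μ h K Λ Λ') (hubbardEffectiveActionCT L M β U μ h K Λ'))) :
    IsUnit (hubbardEffPartitionFnCT L M β U μ h K Λ) :=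
  isUnit_iff_ne_zero.2 (hubbardEffPartitionFnCT_ne_zero_of_slice β U μ h K Λ hZ.ne_zero hstep)

/-- **The ultraviolet end**: if no field is above scale `Λ` (`w^K_Λ ≡ 0`, so `C^K_{>Λ} = 0`) then `Z^K_Λ = 1`. -/
theorem hubbardEffPartitionFnCT_eq_one_of_weight {Λ : ℝ} (hw : ∀ k, hubbardCutoffWeightCT L M β μ K Λ k = 0) :
    hubbardEffPartitionFnCT L M β U μ h K Λ = 1 := by
  unfold hubbardEffPartitionFnCT
  rw [hubbardCovAboveCT_eq_zero_of_weight L M hw, effPartitionFn_zero_cov (constPart_hubbardInteractionCT L M β U K)]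

end Slice

/-! ## §2 The kl-scales: scale by scale and along E1's blocks -/

section Blocks

variable {L M : ℕ} [NeZero L] (β U μ : ℝ) (K : TrigPolyC4v)

/-- **One step on the kl-grid** (any two indices): `Z^K_{Λ_{J₁}} ≠ 0` and `∫dμ_{C^K_{(Λ_{J₂},Λ_{J₁}]}} e^{−𝒱_{J₁}[K]}` a unit `⇒ Z^K_{Λ_{J₂}} ≠ 0` —
the covariance / input are literally those of `klEffectiveAction_eq_effAction_slice … J₂ J₁`. -/
theorem hubbardEffPartitionFnCT_klScale_ne_zero_of_step {J₁ : ℕ} (J₂ : ℕ)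
    (hZ : hubbardEffPartitionFnCT L M β U μ 0 K (klScale klE0 J₁) ≠ 0)
    (hstep : IsUnit (effPartitionFn ℂ (hubbardCovSliceCT L M β μ 0 K (klScale klE0 J₂) (klScale klE0 J₁))
      (klEffectiveAction L M β U μ K klE0 J₁))) :
    hubbardEffPartitionFnCT L M β U μ 0 K (klScale klE0 J₂) ≠ 0 :=
  hubbardEffPartitionFnCT_ne_zero_of_slice β U μ 0 K (klScale klE0 J₂) hZ hstep

/-- **Scale by scale**: `Z^K_{Λ_0} ≠ 0` and, for every `j < m`, (`Z^K_{Λ_j} ≠ 0 ⇒` the single-slice partition function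
`∫dμ_{C^K_{(Λ_{j+1},Λ_j]}} e^{−𝒱_j[K]}` is a unit) `⇒ Z^K_{Λ_j} ≠ 0` for every `j ≤ m`. -/
theorem hubbardEffPartitionFnCT_klScale_succ_ne_zero_of_steps (h0 : hubbardEffPartitionFnCT L M β U μ 0 K (klScale klE0 0) ≠ 0) {m : ℕ}
    (hstep : ∀ j < m, hubbardEffPartitionFnCT L M β U μ 0 K (klScale klE0 j) ≠ 0 →
      IsUnit (effPartitionFn ℂ (hubbardCovSliceCT L M β μ 0 K (klScale klE0 (j + 1)) (klScale klE0 j))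
        (klEffectiveAction L M β U μ K klE0 j))) :
    ∀ j ≤ m, hubbardEffPartitionFnCT L M β U μ 0 K (klScale klE0 j) ≠ 0 := by
  intro j
  induction j with
  | zero => exact fun _ => h0
  | succ j ih =>
      intro hj
      have hj' : j < m := Nat.lt_of_succ_le hj
      have hZj := ih hj'.le
      exact hubbardEffPartitionFnCT_klScale_ne_zero_of_step β U μ K (j + 1) hZj (hstep j hj' hZj)

/-- **ALONG E1's BLOCKS** (`J_k = d·k`, block covariance `Γ_k = C^K_{(Λ_{d(k+1)}, Λ_{dk}]}`, input `klTowerInput … d k = 𝒱_{dk}[K]` — literally the data of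
`klTowerIncr_eq_effAction_sub`): `Z^K_{Λ_0} ≠ 0` and, for every block `k < m`, (`Z^K_{Λ_{dk}} ≠ 0 ⇒ ∫dμ_{Γ_k} e^{−𝒱_{dk}[K]}` a unit)
`⇒ Z^K_{Λ_{dk}} ≠ 0` for every `k ≤ m`.  The implication form of the step hypothesis is the one the tower induction can discharge: the block door
needs `constPart 𝒱_{dk} = 0`, i.e. `Z^K_{Λ_{dk}} ≠ 0`, BEFORE it returns the unit. -/
theorem hubbardEffPartitionFnCT_klScale_blocks_ne_zero (d : ℕ) (h0 : hubbardEffPartitionFnCT L M β U μ 0 K (klScale klE0 0) ≠ 0) {m : ℕ}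
    (hstep : ∀ k < m, hubbardEffPartitionFnCT L M β U μ 0 K (klScale klE0 (d * k)) ≠ 0 →
      IsUnit (effPartitionFn ℂ (hubbardCovSliceCT L M β μ 0 K (klScale klE0 (d * (k + 1))) (klScale klE0 (d * k)))
        (klTowerInput L M β U μ K d k))) :
    ∀ k ≤ m, hubbardEffPartitionFnCT L M β U μ 0 K (klScale klE0 (d * k)) ≠ 0 := by
  intro k
  induction k with
  | zero => exact fun _ => by rw [Nat.mul_zero]; exact h0
  | succ k ih =>
      intro hk
      have hk' : k < m := Nat.lt_of_succ_le hk
      have hZk := ih hk'.le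
      exact hubbardEffPartitionFnCT_klScale_ne_zero_of_step β U μ K (d * (k + 1)) hZk (hstep k hk' hZk)

/-- … hence at EVERY scale `j ≤ d·m` once all blocks `k < m` are through and the last partial block is a unit too: the single index form used by the
carriers (`hZ` of `klEffectiveAction_eq_effAction_slice … j (d·k)`): `Z^K_{Λ_{dk}} ≠ 0`, `∫dμ_{C^K_{(Λ_j,Λ_{dk}]}} e^{−𝒱_{dk}[K]}` a unit `⇒ Z^K_{Λ_j} ≠ 0`. -/
theorem hubbardEffPartitionFnCT_klScale_ne_zero_of_block (d k j : ℕ)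
    (hZ : hubbardEffPartitionFnCT L M β U μ 0 K (klScale klE0 (d * k)) ≠ 0)
    (hstep : IsUnit (effPartitionFn ℂ (hubbardCovSliceCT L M β μ 0 K (klScale klE0 j) (klScale klE0 (d * k)))
      (klTowerInput L M β U μ K d k))) :
    hubbardEffPartitionFnCT L M β U μ 0 K (klScale klE0 j) ≠ 0 :=
  hubbardEffPartitionFnCT_klScale_ne_zero_of_step β U μ K j hZ hstep

end Blocks

/-! ## §3 The step partition function is a unit: plateau transfer of the doors' first conjunct (Literature level) -/

section Plateau

variable {L M : ℕ} [NeZero L] [NeZero M] {N : ℕ} {Lab : Type*} [DecidableEq Lab] {wt : Finset Lab → ℝ}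

/-- **THE STEP PARTITION FUNCTION IS A UNIT, WEIGHTED CURRENCY** (BGM 2006 (2.13)–(2.14), (2.70), §3 (3.2)–(3.8)).  Data as in the Literature
weighted (Hstep) doors: a tree weight `wt`, positions `πl`; thin/fat input families `F, F̃` (`F̃F = F`, `ΣF = 0 ⇒ F = 0`), plateau of `F` over `supp C`;
even `G` without constant part; `C′ = S(F̃)ᵀ C S(F̃)` replica-Gram-bounded (`κ > 0`) with WEIGHTED row/column sums `≤ α`; WEIGHTED input sizes
`Σ_{Y_j = w} wt(πY)·‖kernel (map (toLin' E(F)) G) (2m′) Y‖ ≤ B m′`; radius `ρ`; `θ = eα‖Ṽ‖_h/κ² < 1` with the profile `m′ ↦ ε_x^{2m′} B m′`.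
THEN `∫dμ_C e^{−G}` is a unit.  (No output family, no overlap costs.) -/
theorem isUnit_effPartitionFn_of_plateau_wt (hwt : IsTreeWeight wt) (πl : SpaceTimeIdx L M × SectorLeg N → Lab)
    {β : ℝ} (hβ : 0 < β) (F Ft : Fin N → FreqMomentum L M → ℂ) (hFF : ∀ ω k, Ft ω k * F ω k = F ω k)
    (hF0 : ∀ k, ∑ ω, F ω k = 0 → ∀ ω, F ω k = 0)
    (G : HubbardGrassmann L M) (hG : G ∈ evenPart ℂ (HubbardFieldIdx L M)) (hG0 : constPart ℂ G = 0)
    (C : Matrix (HubbardFieldIdx L M) (HubbardFieldIdx L M) ℂ)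
    (hCpl : ∀ X Y, C X Y ≠ 0 → ∑ ω, F ω X.1.1 = 1 ∧ ∑ ω, F ω Y.1.1 = 1)
    {κ : ℝ} (hκ : 0 < κ) (hGB : IsGramBoundedR ((sectorSubMatrix L M β Ft).transpose * C * sectorSubMatrix L M β Ft) κ)
    (B : ℕ → ℝ) (hB0 : ∀ m', 0 ≤ B m')
    (hB : ∀ (m' : ℕ) (j : Fin (2 * m')) (w : SpaceTimeIdx L M × SectorLeg N),
      ∑ Y ∈ univ.filter (fun Y : Fin (2 * m') → SpaceTimeIdx L M × SectorLeg N => Y j = w),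
        wt ((univ.image Y).image πl) * ‖kernel ℂ (ExteriorAlgebra.map (Matrix.toLin' (sectorAnalysisMatrix L M β F)) G) (2 * m') Y‖ ≤
          B m')
    {α : ℝ} (hα : 0 < α)
    (hrow : ∀ X, ∑ Y, ‖((sectorSubMatrix L M β Ft).transpose * C * sectorSubMatrix L M β Ft) X Y‖ * wt {πl X, πl Y} ≤ α)
    (hcol : ∀ Y, ∑ X, ‖((sectorSubMatrix L M β Ft).transpose * C * sectorSubMatrix L M β Ft) X Y‖ * wt {πl X, πl Y} ≤ α)
    {ρ : ℝ} (hρ : 0 < ρ)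
    (hθ : Real.exp 1 * α * normV (SpaceTimeIdx L M × SectorLeg N) κ ρ (fun m' => imagTimeWeight β M ^ (2 * m') * B m') / κ ^ 2 < 1) :
    IsUnit (effPartitionFn ℂ C G) := by
  classical
  have hε : 0 ≤ imagTimeWeight β M := imagTimeWeight_nonneg hβ.le M
  set C' : Matrix (SpaceTimeIdx L M × SectorLeg N) (SpaceTimeIdx L M × SectorLeg N) ℂ :=
    (sectorSubMatrix L M β Ft).transpose * C * sectorSubMatrix L M β Ft with hC'
  -- the weight pulled back to the sector-field labels is a tree weight
  set wt' : Finset (SpaceTimeIdx L M × SectorLeg N) → ℝ := fun S => wt (S.image πl) with hwt'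
  have hwt'tree : IsTreeWeight wt' := hwt.comap πl
  have hwl : ∀ S, 0 ≤ wt' S := fun S => zero_le_one.trans (hwt'tree.one_le S)
  -- weighted pinned sizes of the preimage `Ṽ = sectorPreimage β F G`
  have hN : ∀ (m' : ℕ) (j : Fin (2 * m')) (w : SpaceTimeIdx L M × SectorLeg N),
      ∑ Y ∈ univ.filter (fun Y : Fin (2 * m') → SpaceTimeIdx L M × SectorLeg N => Y j = w),
        ‖kernel ℂ (sectorPreimage β F G) (2 * m') Y‖ * wt' (univ.image Y) ≤ imagTimeWeight β M ^ (2 * m') * B m' :=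
    fun m' j w => sum_wt_norm_kernel_sectorPreimage_le hβ.le F G wt' hwl (hB0 m') (hB m') j w
  have hN0 : ∀ m', 0 ≤ imagTimeWeight β M ^ (2 * m') * B m' := fun m' => mul_nonneg (pow_nonneg hε _) (hB0 m')
  have hrow₁ : ∀ X, ∑ Y, ‖C' X Y‖ * wt' {X, Y} ≤ α := fun X => by
    simpa only [hwt', image_insert, image_singleton] using hrow X
  have hcol₁ : ∀ Y, ∑ X, ‖C' X Y‖ * wt' {X, Y} ≤ α := fun Y => by
    simpa only [hwt', image_insert, image_singleton] using hcol Y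
  -- the weighted determinant-bounded door, first conjunct, in the sector representation
  have hunit : IsUnit (effPartitionFn ℂ C' (sectorPreimage β F G)) :=
    (sum_wt_norm_kernel_effAction_le_of_gramBounded C' hwt'tree hκ hGB (sectorPreimage β F G) (sectorPreimage_mem_evenPart β F hG)
      (by rw [constPart_sectorPreimage, hG0]) _ hN0 hN hα hrow₁ hcol₁ hρ hθ).1
  -- the partition function does not see the plateau rescaling
  rw [← effPartitionFn_map_sectorSub_sectorPreimage_of_plateau hβ.ne' F Ft hFF hF0 G C hCpl, effPartitionFn_map,
    LinearMap.toMatrix'_toLin']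
  exact hunit

/-- **THE STEP PARTITION FUNCTION IS A UNIT, PRESCRIBED (LEVELLED) CURRENCY** (BGM 2006 (2.13)–(2.14), (2.70), (2.88)–(2.90), §3).  Same plateau
data; UNWEIGHTED row/column sums `≤ α`; the input sizes in the prescribed-legs currency of the Literature prescribed doors,
`ε_x^{2m′+1}·Σ_{σ prescribed on E ∋ q, #E = Fc+1} Σ_{x pinned at q} ‖sectorisedKernel F G (2m′+2) σ x‖ ≤ B (m′+1) Fc`; `θ < 1` with the profile
`m′ ↦ ρc^0·(ε_x · B m′ 0)` (any `ρc`).  THEN `∫dμ_C e^{−G}` is a unit. -/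
theorem isUnit_effPartitionFn_of_plateau_prescribed {β : ℝ} (hβ : 0 < β) (F Ft : Fin N → FreqMomentum L M → ℂ)
    (hFF : ∀ ω k, Ft ω k * F ω k = F ω k) (hF0 : ∀ k, ∑ ω, F ω k = 0 → ∀ ω, F ω k = 0)
    (G : HubbardGrassmann L M) (hG : G ∈ evenPart ℂ (HubbardFieldIdx L M)) (hG0 : constPart ℂ G = 0)
    (C : Matrix (HubbardFieldIdx L M) (HubbardFieldIdx L M) ℂ)
    (hCpl : ∀ X Y, C X Y ≠ 0 → ∑ ω, F ω X.1.1 = 1 ∧ ∑ ω, F ω Y.1.1 = 1)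
    {κ : ℝ} (hκ : 0 < κ) (hGB : IsGramBoundedR ((sectorSubMatrix L M β Ft).transpose * C * sectorSubMatrix L M β Ft) κ)
    (B : ℕ → ℕ → ℝ) (hB0 : ∀ m' Fc, 0 ≤ B m' Fc)
    (hB : ∀ (m' Fc : ℕ) (E : Finset (Fin (2 * m' + 1 + 1))) (τ : Fin (2 * m' + 1 + 1) → SectorLeg N) (q : Fin (2 * m' + 1 + 1)),
      q ∈ E → E.card = Fc + 1 → ∀ y : SpaceTimeIdx L M,
        imagTimeWeight β M ^ (2 * m' + 1) *
          ∑ σ ∈ univ.filter (fun σ : Fin (2 * m' + 1 + 1) → SectorLeg N => ∀ e ∈ E, σ e = τ e),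
            ∑ x ∈ univ.filter (fun x : Fin (2 * m' + 1 + 1) → SpaceTimeIdx L M => x q = y), ‖sectorisedKernel L M β F G (2 * m' + 1 + 1) σ x‖ ≤
          B (m' + 1) Fc)
    {α : ℝ} (hα : 0 < α)
    (hrow : ∀ X, ∑ Y, ‖((sectorSubMatrix L M β Ft).transpose * C * sectorSubMatrix L M β Ft) X Y‖ ≤ α)
    (hcol : ∀ Y, ∑ X, ‖((sectorSubMatrix L M β Ft).transpose * C * sectorSubMatrix L M β Ft) X Y‖ ≤ α)
    {ρ : ℝ} (hρ : 0 < ρ) {ρc : ℝ}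
    (hθ : Real.exp 1 * α * normV (SpaceTimeIdx L M × SectorLeg N) κ ρ (fun m' => ρc ^ 0 * (imagTimeWeight β M * B m' 0)) / κ ^ 2 < 1) :
    IsUnit (effPartitionFn ℂ C G) := by
  classical
  have hε : 0 ≤ imagTimeWeight β M := imagTimeWeight_nonneg hβ.le M
  set C' : Matrix (SpaceTimeIdx L M × SectorLeg N) (SpaceTimeIdx L M × SectorLeg N) ℂ :=
    (sectorSubMatrix L M β Ft).transpose * C * sectorSubMatrix L M β Ft with hC'
  -- plain pinned sizes of the preimage from the `Fc = 0` prescribed sizes (the bridge with no prescribed slot)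
  have hN : ∀ (m' : ℕ) (j : Fin (2 * m')) (w : SpaceTimeIdx L M × SectorLeg N),
      ∑ Y ∈ univ.filter (fun Y : Fin (2 * m') → SpaceTimeIdx L M × SectorLeg N => Y j = w),
        ‖kernel ℂ (sectorPreimage β F G) (2 * m') Y‖ ≤ ρc ^ 0 * (imagTimeWeight β M * B m' 0) := by
    intro m'
    rcases m' with _ | m'
    · intro j
      exact Fin.elim0 (Fin.cast (Nat.mul_zero 2) j)
    · rw [show 2 * (m' + 1) = 2 * m' + 1 + 1 by ring, pow_zero, one_mul]
      intro j w
      have h := sum_norm_kernel_sectorPreimage_prescribedSlots_le_of_prescribedSum_le hβ.le F G (2 * m' + 1) (Fc := 0)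
        (B := B (m' + 1) 0) (fun E τ q hq hE y => hB m' 0 E τ q hq hE y) (∅ : Finset (Fin 1)) rfl
        (fun i : ((∅ : Finset (Fin 1)) : Set (Fin 1)) => (Finset.notMem_empty _ i.2).elim)
        (fun i => (Finset.notMem_empty _ i.2).elim) j (fun i => (Finset.notMem_empty _ i.2).elim)
        (fun i => (Finset.notMem_empty _ i.2).elim) w
      refine le_of_eq_of_le (sum_congr rfl fun Y _ => ?_) h
      rw [Fintype.prod_empty, mul_one]
  have hN0 : ∀ m', 0 ≤ ρc ^ 0 * (imagTimeWeight β M * B m' 0) := fun m' => by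
    rw [pow_zero, one_mul]; exact mul_nonneg hε (hB0 _ _)
  -- the determinant-bounded door, first conjunct, in the sector representation
  have hunit : IsUnit (effPartitionFn ℂ C' (sectorPreimage β F G)) :=
    (sum_norm_kernel_effAction_add_sum_cumulant_le_of_gramBounded C' hκ hGB (sectorPreimage β F G) (sectorPreimage_mem_evenPart β F hG)
      (by rw [constPart_sectorPreimage, hG0]) _ hN0 hN hα hrow hcol hρ hθ one_pos).1
  rw [← effPartitionFn_map_sectorSub_sectorPreimage_of_plateau hβ.ne' F Ft hFF hF0 G C hCpl, effPartitionFn_map,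
    LinearMap.toMatrix'_toLin']
  exact hunit

end Plateau

/-! ## §4 E1's block geometry: the unit of a block step in both currencies -/

section BlockStep

variable {L M : ℕ} [NeZero L] [NeZero M] {Lab : Type*} [DecidableEq Lab] {wt : Finset Lab → ℝ}

/-- **THE BLOCK-STEP PARTITION FUNCTION IS A UNIT, WEIGHTED TRACK**: `1 ≤ J₁ ≤ J₂`, `F := F_{J₁−1}`, `F̃ := F̃_{J₁−1}`,
`Γ := C^K_{(Λ_{J₂}, Λ_{J₁}]}`; `G` even without constant part; the block constants of `blockStep_ordersGe2_wt_le` (`κ`, weighted `α`, `ρ`, `θ < 1`) and the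
weighted input sizes `B m′` of `G` at `F` — the SAME terms, no output data.  Conclusion: `IsUnit ∫dμ_Γ e^{−G}`. -/
theorem isUnit_effPartitionFn_blockStep_wt (hwt : IsTreeWeight wt) {β : ℝ} (hβ : 0 < β) (μ : ℝ) (K : TrigPolyC4v) {J₁ J₂ : ℕ}
    (hJ₁ : 1 ≤ J₁) (hJ : J₁ ≤ J₂)
    (πi : SpaceTimeIdx L M × SectorLeg (sectorCount (J₁ - 1)) → Lab)
    (G : HubbardGrassmann L M) (hG : G ∈ evenPart ℂ (HubbardFieldIdx L M)) (hG0 : constPart ℂ G = 0)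
    {κ : ℝ} (hκ : 0 < κ)
    (hGB : IsGramBoundedR ((sectorSubMatrix L M β (bgmFatMultiplier L M klE0 β (nambuXiCT L μ K) (J₁ - 1))).transpose *
      hubbardCovSliceCT L M β μ 0 K (klScale klE0 J₂) (klScale klE0 J₁) *
        sectorSubMatrix L M β (bgmFatMultiplier L M klE0 β (nambuXiCT L μ K) (J₁ - 1))) κ)
    (B : ℕ → ℝ) (hB0 : ∀ m', 0 ≤ B m')
    (hB : ∀ (m' : ℕ) (j : Fin (2 * m')) (w : SpaceTimeIdx L M × SectorLeg (sectorCount (J₁ - 1))),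
      ∑ Y ∈ univ.filter (fun Y : Fin (2 * m') → SpaceTimeIdx L M × SectorLeg (sectorCount (J₁ - 1)) => Y j = w),
        wt ((univ.image Y).image πi) *
          ‖kernel ℂ (ExteriorAlgebra.map (Matrix.toLin' (sectorAnalysisMatrix L M β (klAnisoFamily L M β μ K klE0 (J₁ - 1)))) G) (2 * m') Y‖ ≤
        B m')
    {α : ℝ} (hα : 0 < α)
    (hrow : ∀ X, ∑ Y, ‖((sectorSubMatrix L M β (bgmFatMultiplier L M klE0 β (nambuXiCT L μ K) (J₁ - 1))).transpose *
        hubbardCovSliceCT L M β μ 0 K (klScale klE0 J₂) (klScale klE0 J₁) *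
          sectorSubMatrix L M β (bgmFatMultiplier L M klE0 β (nambuXiCT L μ K) (J₁ - 1))) X Y‖ * wt {πi X, πi Y} ≤ α)
    (hcol : ∀ Y, ∑ X, ‖((sectorSubMatrix L M β (bgmFatMultiplier L M klE0 β (nambuXiCT L μ K) (J₁ - 1))).transpose *
        hubbardCovSliceCT L M β μ 0 K (klScale klE0 J₂) (klScale klE0 J₁) *
          sectorSubMatrix L M β (bgmFatMultiplier L M klE0 β (nambuXiCT L μ K) (J₁ - 1))) X Y‖ * wt {πi X, πi Y} ≤ α)
    {ρ : ℝ} (hρ : 0 < ρ)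
    (hθ : Real.exp 1 * α * normV (SpaceTimeIdx L M × SectorLeg (sectorCount (J₁ - 1))) κ ρ (fun m' => imagTimeWeight β M ^ (2 * m') * B m') / κ ^ 2 < 1) :
    IsUnit (effPartitionFn ℂ (hubbardCovSliceCT L M β μ 0 K (klScale klE0 J₂) (klScale klE0 J₁)) G) := by
  have he : (0 : ℝ) < klE0 := by norm_num [klE0]
  exact isUnit_effPartitionFn_of_plateau_wt hwt πi hβ (klAnisoFamily L M β μ K klE0 (J₁ - 1))
    (bgmFatMultiplier L M klE0 β (nambuXiCT L μ K) (J₁ - 1)) (fun ω k => bgmFatMultiplier_mul_bgmMultiplier he β (nambuXiCT L μ K) (J₁ - 1) ω k)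
    (fun k hk ω => klAnisoFamily_eq_zero_of_sum_eq_zero β μ K klE0 (J₁ - 1) k hk ω) G hG hG0 _
    (fun X Y hXY => sum_klAnisoFamily_eq_one_of_blockSliceCT_ne_zero β μ K hJ₁ hJ X Y hXY) hκ hGB B hB0 hB hα hrow hcol hρ hθ

/-- **THE BLOCK-STEP PARTITION FUNCTION IS A UNIT, LEVELLED (PRESCRIBED-LEGS) TRACK**: the same with the block constants and the prescribed input
sizes `B m′ Fc` of `blockStep_ordersGe2_lev_le` (unweighted `α`, `θ < 1` with the profile `m′ ↦ 27^0·(ε_x·B m′ 0)`) — the SAME terms, no output data.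
Conclusion: `IsUnit ∫dμ_Γ e^{−G}`. -/
theorem isUnit_effPartitionFn_blockStep_lev {β : ℝ} (hβ : 0 < β) (μ : ℝ) (K : TrigPolyC4v) {J₁ J₂ : ℕ} (hJ₁ : 1 ≤ J₁) (hJ : J₁ ≤ J₂)
    (G : HubbardGrassmann L M) (hG : G ∈ evenPart ℂ (HubbardFieldIdx L M)) (hG0 : constPart ℂ G = 0)
    {κ : ℝ} (hκ : 0 < κ)
    (hGB : IsGramBoundedR ((sectorSubMatrix L M β (bgmFatMultiplier L M klE0 β (nambuXiCT L μ K) (J₁ - 1))).transpose *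
      hubbardCovSliceCT L M β μ 0 K (klScale klE0 J₂) (klScale klE0 J₁) *
        sectorSubMatrix L M β (bgmFatMultiplier L M klE0 β (nambuXiCT L μ K) (J₁ - 1))) κ)
    (B : ℕ → ℕ → ℝ) (hB0 : ∀ m' Fc, 0 ≤ B m' Fc)
    (hB : ∀ (m' Fc : ℕ) (E : Finset (Fin (2 * m' + 1 + 1))) (τ : Fin (2 * m' + 1 + 1) → SectorLeg (sectorCount (J₁ - 1)))
      (q : Fin (2 * m' + 1 + 1)), q ∈ E → E.card = Fc + 1 → ∀ y : SpaceTimeIdx L M,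
        imagTimeWeight β M ^ (2 * m' + 1) *
          ∑ σ ∈ univ.filter (fun σ : Fin (2 * m' + 1 + 1) → SectorLeg (sectorCount (J₁ - 1)) => ∀ e ∈ E, σ e = τ e),
            ∑ x ∈ univ.filter (fun x : Fin (2 * m' + 1 + 1) → SpaceTimeIdx L M => x q = y),
              ‖sectorisedKernel L M β (klAnisoFamily L M β μ K klE0 (J₁ - 1)) G (2 * m' + 1 + 1) σ x‖ ≤ B (m' + 1) Fc)
    {α : ℝ} (hα : 0 < α)
    (hrow : ∀ X, ∑ Y, ‖((sectorSubMatrix L M β (bgmFatMultiplier L M klE0 β (nambuXiCT L μ K) (J₁ - 1))).transpose *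
        hubbardCovSliceCT L M β μ 0 K (klScale klE0 J₂) (klScale klE0 J₁) *
          sectorSubMatrix L M β (bgmFatMultiplier L M klE0 β (nambuXiCT L μ K) (J₁ - 1))) X Y‖ ≤ α)
    (hcol : ∀ Y, ∑ X, ‖((sectorSubMatrix L M β (bgmFatMultiplier L M klE0 β (nambuXiCT L μ K) (J₁ - 1))).transpose *
        hubbardCovSliceCT L M β μ 0 K (klScale klE0 J₂) (klScale klE0 J₁) *
          sectorSubMatrix L M β (bgmFatMultiplier L M klE0 β (nambuXiCT L μ K) (J₁ - 1))) X Y‖ ≤ α)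
    {ρ : ℝ} (hρ : 0 < ρ)
    (hθ : Real.exp 1 * α * normV (SpaceTimeIdx L M × SectorLeg (sectorCount (J₁ - 1))) κ ρ
      (fun m' => (27 : ℝ) ^ 0 * (imagTimeWeight β M * B m' 0)) / κ ^ 2 < 1) :
    IsUnit (effPartitionFn ℂ (hubbardCovSliceCT L M β μ 0 K (klScale klE0 J₂) (klScale klE0 J₁)) G) := by
  have he : (0 : ℝ) < klE0 := by norm_num [klE0]
  exact isUnit_effPartitionFn_of_plateau_prescribed hβ (klAnisoFamily L M β μ K klE0 (J₁ - 1))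
    (bgmFatMultiplier L M klE0 β (nambuXiCT L μ K) (J₁ - 1)) (fun ω k => bgmFatMultiplier_mul_bgmMultiplier he β (nambuXiCT L μ K) (J₁ - 1) ω k)
    (fun k hk ω => klAnisoFamily_eq_zero_of_sum_eq_zero β μ K klE0 (J₁ - 1) k hk ω) G hG hG0 _
    (fun X Y hXY => sum_klAnisoFamily_eq_one_of_blockSliceCT_ne_zero β μ K hJ₁ hJ X Y hXY) hκ hGB B hB0 hB hα hrow hcol hρ hθ

/-- **THE TOWER FORM** (E1's induction step for «(Z)», weighted track): at block `k ≥ 1` of length `d ≥ 1` (`J₁ = dk`, `J₂ = d(k+1)`, input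
`klTowerInput … d k = 𝒱_{dk}[K]`, even by `klEffectiveAction_mem_evenPart`, without constant part by `Z^K_{Λ_{dk}} ≠ 0`): `Z^K_{Λ_{dk}} ≠ 0` and the
block-door data of `blockStep_ordersGe2_wt_le` at `G := klTowerInput … d k` `⇒ Z^K_{Λ_{d(k+1)}} ≠ 0`. -/
theorem hubbardEffPartitionFnCT_klScale_block_succ_ne_zero_wt (hwt : IsTreeWeight wt) {β : ℝ} (hβ : 0 < β) (U μ : ℝ) (K : TrigPolyC4v)
    {d k : ℕ} (hd : 1 ≤ d) (hk : 1 ≤ k)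
    (hZ : hubbardEffPartitionFnCT L M β U μ 0 K (klScale klE0 (d * k)) ≠ 0)
    (πi : SpaceTimeIdx L M × SectorLeg (sectorCount (d * k - 1)) → Lab)
    {κ : ℝ} (hκ : 0 < κ)
    (hGB : IsGramBoundedR ((sectorSubMatrix L M β (bgmFatMultiplier L M klE0 β (nambuXiCT L μ K) (d * k - 1))).transpose *
      hubbardCovSliceCT L M β μ 0 K (klScale klE0 (d * (k + 1))) (klScale klE0 (d * k)) *
        sectorSubMatrix L M β (bgmFatMultiplier L M klE0 β (nambuXiCT L μ K) (d * k - 1))) κ)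
    (B : ℕ → ℝ) (hB0 : ∀ m', 0 ≤ B m')
    (hB : ∀ (m' : ℕ) (j : Fin (2 * m')) (w : SpaceTimeIdx L M × SectorLeg (sectorCount (d * k - 1))),
      ∑ Y ∈ univ.filter (fun Y : Fin (2 * m') → SpaceTimeIdx L M × SectorLeg (sectorCount (d * k - 1)) => Y j = w),
        wt ((univ.image Y).image πi) *
          ‖kernel ℂ (ExteriorAlgebra.map (Matrix.toLin' (sectorAnalysisMatrix L M β (klAnisoFamily L M β μ K klE0 (d * k - 1))))
            (klTowerInput L M β U μ K d k)) (2 * m') Y‖ ≤ B m')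
    {α : ℝ} (hα : 0 < α)
    (hrow : ∀ X, ∑ Y, ‖((sectorSubMatrix L M β (bgmFatMultiplier L M klE0 β (nambuXiCT L μ K) (d * k - 1))).transpose *
        hubbardCovSliceCT L M β μ 0 K (klScale klE0 (d * (k + 1))) (klScale klE0 (d * k)) *
          sectorSubMatrix L M β (bgmFatMultiplier L M klE0 β (nambuXiCT L μ K) (d * k - 1))) X Y‖ * wt {πi X, πi Y} ≤ α)
    (hcol : ∀ Y, ∑ X, ‖((sectorSubMatrix L M β (bgmFatMultiplier L M klE0 β (nambuXiCT L μ K) (d * k - 1))).transpose *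
        hubbardCovSliceCT L M β μ 0 K (klScale klE0 (d * (k + 1))) (klScale klE0 (d * k)) *
          sectorSubMatrix L M β (bgmFatMultiplier L M klE0 β (nambuXiCT L μ K) (d * k - 1))) X Y‖ * wt {πi X, πi Y} ≤ α)
    {ρ : ℝ} (hρ : 0 < ρ)
    (hθ : Real.exp 1 * α * normV (SpaceTimeIdx L M × SectorLeg (sectorCount (d * k - 1))) κ ρ
      (fun m' => imagTimeWeight β M ^ (2 * m') * B m') / κ ^ 2 < 1) :
    hubbardEffPartitionFnCT L M β U μ 0 K (klScale klE0 (d * (k + 1))) ≠ 0 := by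
  have hJ₁ : 1 ≤ d * k := le_trans hd (Nat.le_mul_of_pos_right d hk)
  have hJ : d * k ≤ d * (k + 1) := Nat.mul_le_mul_left d (Nat.le_succ k)
  have hG : klTowerInput L M β U μ K d k ∈ evenPart ℂ (HubbardFieldIdx L M) := klEffectiveAction_mem_evenPart hβ.ne' U μ K klE0 (d * k)
  have hG0 : constPart ℂ (klTowerInput L M β U μ K d k) = 0 := constPart_klEffectiveAction_eq_zero β U μ K klE0 (d * k) hZ
  exact hubbardEffPartitionFnCT_klScale_ne_zero_of_block β U μ K d k (d * (k + 1)) hZ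
    (isUnit_effPartitionFn_blockStep_wt hwt hβ μ K hJ₁ hJ πi (klTowerInput L M β U μ K d k) hG hG0 hκ hGB B hB0 hB hα hrow hcol hρ hθ)

end BlockStep

end Summit.HubbardSuperconductivity.HubbardSuperconductivity.Theorems.EngineV8

end
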